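import Literature.IUT.LogVolume.InitialThetaDataBadPlaceRamification
import Mathlib.NumberTheory.NumberField.Discriminant.Different
import HarnessLib

/-!
# The primes under the bad places of `K = F(E_F[l])` divide `disc(K)` (Dedekind's discriminant theorem applied to
# `e(w|p) ≥ l ≥ 5`; proof-only sequel of `InitialThetaDataBadPlaceRamification.lean`)

abc-iut cell, WAVE-5 prover seat abc-iut-w5-d009 (gen 7); kernel INPUT for the C lead's question C-R19 (Q1) (HOME/STATUS
2026-08-26T09:44:14Z). The branch-C «case A» refutation of the hull-level licence (abc-iut-C-cert-2,
`Thm311.Real.not_licence_settingPrVolSharp_of_deep_unramified`, p433074) carries the hypothesis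
`hdisc : ¬ (p : ℤ) ∣ NumberField.discr L` at the prime `p` under the deep packet, `L` the field of the pilot data. At the
`K`-LEVEL genuine datum of repair R1 (`L := K`, bad set = the places of `K` over `𝕍(F)^bad`) this hypothesis FAILS at every
prime under a bad place: such a place `w` has absolute ramification index `e(w|p) ≥ l ≥ 5`
(`ThetaData.one_lt_absRamificationIdx_of_under_mem_VFbad`, this seat's p436297, from [IUTchI] Def. 3.1 (c) + Ex. 3.2 (iv)),
so `w` is ramified over `ℤ`, so `p ∣ disc(K)` by Dedekind's discriminant theorem (Mathlib
`NumberField.not_dvd_discr_iff_forall_mem` + `Ideal.ramificationIdx_eq_one_of_isUnramifiedAt`; Neukirch ANT III (2.12)).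

* `ThetaData.not_isUnramifiedAt_int_of_under_mem_VFbad` — a bad place of `K` is not unramified over `ℤ`;
* **`ThetaData.natCast_dvd_discr_of_under_mem_VFbad`** — `(p : ℤ) ∣ NumberField.discr K` for every prime `p ∈ w`, `w` bad;
* `ThetaData.not_not_dvd_discr_of_under_mem_VFbad` — the literal negation of the `hdisc` binder shape.

PROOF-ONLY (0 `def`, 0 new `Prop`); classical. Nothing here bears on [IUTchIII] Cor. 3.12; no side taken on any author.
[cite: NeukirchANT1999, Ch. III Thm. (2.12)] [cite: Mochizuki2012, IUTchI Def. 3.1 (c) p. 62; Ex. 3.2 (iv) p. 71]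
[claim: Mochizuki2012, status: disputed] for the IUT quotations.
-/

noncomputable section

open scoped Classical

namespace Literature.IUT.LogVolume

namespace ThetaData

open Literature.IUT.HodgeTheaters NumberField IsDedekindDomain WeierstrassCurve

variable {F K Fbar : Type} [Field F] [NumberField F] [Field K] [NumberField K] [Algebra F K]
  [Field Fbar] [Algebra F Fbar] [Algebra K Fbar] {E : WeierstrassCurve F} [E.IsElliptic] {l : ℕ}
  {Pb : BadPlacePredicates K} (D : InitialThetaData F K Fbar E l Pb)

/-- **A bad place of `K` is NOT unramified over `ℤ`** (`e(w|p) > 1`, `one_lt_absRamificationIdx_of_under_mem_VFbad`, versus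
Mathlib's `Ideal.ramificationIdx_eq_one_of_isUnramifiedAt`). [cite: NeukirchANT1999, Ch. III Thm. (2.12)] -/
theorem not_isUnramifiedAt_int_of_under_mem_VFbad {w : HeightOneSpectrum (𝓞 K)}
    (hw : FinitePlace.mk (w.under (𝓞 F)) ∈ D.VFbad) : ¬ Algebra.IsUnramifiedAt ℤ w.asIdeal := by
  intro h
  exact absRamificationIdx_ne_one_of_under_mem_VFbad D hw (Ideal.ramificationIdx_eq_one_of_isUnramifiedAt)

/-- **The prime under a bad place of `K` divides `disc(K)`**: for every place `w` of `K` over `𝕍(F)^bad` and every rational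
prime `p ∈ w` (i.e. `w ∣ p`), `(p : ℤ) ∣ NumberField.discr K` (Dedekind's discriminant theorem, Mathlib
`NumberField.not_dvd_discr_iff_forall_mem`, applied to the ramified prime `w`). Consequently the «odd UNRAMIFIED prime»
hypothesis `¬ (p : ℤ) ∣ discr` of the branch-C case-A refutation cannot be met at any prime under a bad place of the
`K`-level genuine datum. [cite: NeukirchANT1999, Ch. III Thm. (2.12)] -/
theorem natCast_dvd_discr_of_under_mem_VFbad {w : HeightOneSpectrum (𝓞 K)}
    (hw : FinitePlace.mk (w.under (𝓞 F)) ∈ D.VFbad) {p : ℕ} [Fact p.Prime] (hp : ((p : ℕ) : 𝓞 K) ∈ w.asIdeal) :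
    (p : ℤ) ∣ NumberField.discr K := by
  by_contra hdisc
  have hP : Prime (p : ℤ) := Nat.prime_iff_prime_int.mp Fact.out
  haveI : Algebra.IsUnramifiedAt ℤ w.asIdeal :=
    (NumberField.not_dvd_discr_iff_forall_mem K (𝓞 K) hP).mp hdisc w.asIdeal inferInstance (by exact_mod_cast hp)
  exact not_isUnramifiedAt_int_of_under_mem_VFbad D hw inferInstance

/-- The literal negation of the case-A binder shape `hdisc : ¬ (p : ℤ) ∣ NumberField.discr K` at a prime under a bad place
of `K`. [cite: NeukirchANT1999, Ch. III Thm. (2.12)] -/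
theorem not_not_dvd_discr_of_under_mem_VFbad {w : HeightOneSpectrum (𝓞 K)}
    (hw : FinitePlace.mk (w.under (𝓞 F)) ∈ D.VFbad) {p : ℕ} [Fact p.Prime] (hp : ((p : ℕ) : 𝓞 K) ∈ w.asIdeal) :
    ¬ ¬ ((p : ℕ) : ℤ) ∣ NumberField.discr K :=
  not_not.mpr (natCast_dvd_discr_of_under_mem_VFbad D hw hp)

end ThetaData

/-! ## In pilot-data currency (the `K`-level datum of repair R1: bad set over `𝕍(F)^bad`) -/

namespace PilotData

open Literature.IUT.HodgeTheaters NumberField IsDedekindDomain WeierstrassCurve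

variable {F K Fbar : Type} [Field F] [NumberField F] [Field K] [NumberField K] [Algebra F K]
  [Field Fbar] [Algebra F Fbar] [Algebra K Fbar] {E : WeierstrassCurve F} [E.IsElliptic] {l : ℕ}
  {Pb : BadPlacePredicates K} (D : InitialThetaData F K Fbar E l Pb)

/-- For ANY pilot data `Y` over `K` whose bad set lies over `𝕍(F)^bad` (the `K`-level datum of repair R1, e.g.
`Cor312Prov.pilotDataOfK`): every `w ∈ Y.S` and every prime `p ∈ w` has `p ∣ disc(K)` — no bad packet of the `K`-level line
sits at a prime unramified in `K`. [cite: NeukirchANT1999, Ch. III Thm. (2.12)] -/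
theorem natCast_dvd_discr_of_mem_S (Y : PilotData K)
    (hS : ∀ w ∈ Y.S, FinitePlace.mk (w.under (𝓞 F)) ∈ D.VFbad)
    {w : HeightOneSpectrum (𝓞 K)} (hw : w ∈ Y.S) {p : ℕ} [Fact p.Prime] (hp : ((p : ℕ) : 𝓞 K) ∈ w.asIdeal) :
    (p : ℤ) ∣ NumberField.discr K :=
  ThetaData.natCast_dvd_discr_of_under_mem_VFbad D (hS w hw) hp

end PilotData

end Literature.IUT.LogVolume

end
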